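import Summits.CriticalPhenomena.Ising3DConformalLimit.Theses.LinkingParityCircles
import Summits.CriticalPhenomena.Ising3DConformalLimit.Theses.CurrentConnectionInvariance
import Literature.Probability.LatticeModels.TwistedPlusExpect
import Summits.CriticalPhenomena.Ising3DConformalLimit.Theorems.LinkingParityCirclesSpinRatioMoebiusEvenCorrPositive
import Summits.CriticalPhenomena.Ising3DConformalLimit.Theorems.LinkingParityCirclesSpinRatioMoebiusStubScalingLimitOfRatioLimit
import HarnessLib

/-!
# Crux `LinkingParityCircles.SpinRatioMoebius` (stmt-CriticalPhenomena-4530), line `registered` —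
# the open stub `stub_ratioLimitExists` from item stmt-CriticalPhenomena-4841 `CurrentConnectionInvariance.RatioLimit`

Kernel-checked bridge between the two sibling routes (kill criterion (d) of `LinkingParityCircles`): the telescoping
ratio limits of route `CurrentConnectionInvariance` (`R_n = G_n G_2 / G_{n+2} → p_n` locally uniformly, `p_n` continuous
and positive, all even `n ≥ 2` — item 4841, OPEN) give the pairing-ratio limits of this crux at every level
(`ratioLimitExists_of_CCIRatioLimit`, registered sub-goal of stmt-4530): by induction on `m`, with `y` the
configuration `x` minus its last pair `(x_m, x_{2m+1})` and `z = (y, x_m, x_{2m+1})` a reindexing of `x`,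
`Q_{m+1}(x) = Q_m(y) / R_{2m}(z)` EXACTLY on the lattice (`pairing_succ_eq`; all even critical correlators are `> 0`,
`criticalCorr_pos_of_even`, file `…EvenCorrPositive.lean`), and locally
uniform limit algebra (`TendstoLocallyUniformlyOn.comp`, `.div₀`).

References: S. Friedli, Y. Velenik (CUP 2017) Thm. 3.20 (GKS); H. Duminil-Copin (2019) Thm. 4.8 (two-point positivity).
-/

noncomputable section

namespace Summit.CriticalPhenomena.Ising3DConformalLimit.Cruxes.SpinRatioMoebius.Birth

open Literature.Probability.LatticeModels Filter Set Metric Finset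
open Summit.CriticalPhenomena.Ising3DConformalLimit.Cruxes.IsingEuclidUpgradeR4NonGaussian.FreeCovarianceDeltaDichotomy
  (criticalCorr_two_pos')
open scoped Topology symmDiff

/-! ## §A Reindexing -/

/-- Critical correlators are invariant under bijective reindexing (possibly across arity expressions). [folklore] -/
theorem criticalCorr_comp_bijective {d n n' : ℕ} (σ : Fin n → Fin n') (hσ : Function.Bijective σ) (y : Fin n' → Site d) :
    criticalCorr d n (y ∘ σ) = criticalCorr d n' y := by
  show plusExpect d (criticalBeta d) 0 (spinMonomial (y ∘ σ)) = plusExpect d (criticalBeta d) 0 (spinMonomial y)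
  congr 1
  funext s
  unfold spinMonomial
  exact Fintype.prod_bijective σ hσ _ _ fun i => rfl

/-! ## §B Dropping the last pair: the reduced configuration `y` and the reindexed configuration `z` -/

section Reindex

variable {m : ℕ}

/-- Continuity of `x ↦ y(x) = (x_0, …, x_{m-1}, x_{m+1}, …, x_{2m})` (drop the last pair). [folklore] -/
theorem continuous_dropPair (m : ℕ) :
    Continuous fun x : Fin ((m + 1) + (m + 1)) → EuclideanSpace ℝ (Fin 3) =>
      (Fin.append (fun j : Fin m => x (Fin.castAdd (m + 1) (Fin.castSucc j)))
        (fun j : Fin m => x (Fin.natAdd (m + 1) (Fin.castSucc j))) : Fin (m + m) → EuclideanSpace ℝ (Fin 3)) := by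
  refine continuous_pi fun i => ?_
  refine Fin.addCases (fun j => ?_) (fun j => ?_) i
  · simp only [Fin.append_left]; exact continuous_apply _
  · simp only [Fin.append_right]; exact continuous_apply _

/-- Continuity of `x ↦ z(x) = (y(x), x_m, x_{2m+1})`. [folklore] -/
theorem continuous_reindex (m : ℕ) :
    Continuous fun x : Fin ((m + 1) + (m + 1)) → EuclideanSpace ℝ (Fin 3) =>
      (Fin.append (Fin.append (fun j : Fin m => x (Fin.castAdd (m + 1) (Fin.castSucc j)))
          (fun j : Fin m => x (Fin.natAdd (m + 1) (Fin.castSucc j))))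
        ![x (Fin.castAdd (m + 1) (Fin.last m)), x (Fin.natAdd (m + 1) (Fin.last m))] :
        Fin ((m + m) + 2) → EuclideanSpace ℝ (Fin 3)) := by
  refine continuous_pi fun i => ?_
  refine Fin.addCases (fun j => ?_) (fun j => ?_) i
  · simp only [Fin.append_left]
    refine Fin.addCases (fun k => ?_) (fun k => ?_) j
    · simp only [Fin.append_left]; exact continuous_apply _
    · simp only [Fin.append_right]; exact continuous_apply _
  · simp only [Fin.append_right]
    fin_cases j
    · exact continuous_apply _
    · exact continuous_apply _

/-- The four index families `castAdd ∘ castSucc`, `natAdd ∘ castSucc`, `castAdd last`, `natAdd last` are pairwise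
distinct (values `j`, `m+1+j`, `m`, `2m+1`). [folklore] -/
theorem dropPair_injective {x : Fin ((m + 1) + (m + 1)) → EuclideanSpace ℝ (Fin 3)} (hx : Function.Injective x) :
    Function.Injective (Fin.append (fun j : Fin m => x (Fin.castAdd (m + 1) (Fin.castSucc j)))
        (fun j : Fin m => x (Fin.natAdd (m + 1) (Fin.castSucc j))) : Fin (m + m) → EuclideanSpace ℝ (Fin 3)) := by
  intro i i' h
  induction i using Fin.addCases with
  | left j =>
    induction i' using Fin.addCases with
    | left j' =>
      simp only [Fin.append_left] at h
      have := hx h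
      have hv : (Fin.castSucc j).val = (Fin.castSucc j').val := by
        have := congrArg Fin.val this; simpa using this
      simp at hv
      exact congrArg _ (Fin.ext hv)
    | right j' =>
      simp only [Fin.append_left, Fin.append_right] at h
      have := congrArg Fin.val (hx h)
      simp at this
      omega
  | right j =>
    induction i' using Fin.addCases with
    | left j' =>
      simp only [Fin.append_left, Fin.append_right] at h
      have := congrArg Fin.val (hx h)
      simp at this
      omega
    | right j' =>
      simp only [Fin.append_right] at h
      have := congrArg Fin.val (hx h)
      simp at this
      exact congrArg _ (Fin.ext (by simpa using this))

/-- `z(x)` is injective when `x` is. [folklore] -/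
theorem reindex_injective {x : Fin ((m + 1) + (m + 1)) → EuclideanSpace ℝ (Fin 3)} (hx : Function.Injective x) :
    Function.Injective (Fin.append (Fin.append (fun j : Fin m => x (Fin.castAdd (m + 1) (Fin.castSucc j)))
          (fun j : Fin m => x (Fin.natAdd (m + 1) (Fin.castSucc j))))
        ![x (Fin.castAdd (m + 1) (Fin.last m)), x (Fin.natAdd (m + 1) (Fin.last m))] :
        Fin ((m + m) + 2) → EuclideanSpace ℝ (Fin 3)) := by
  have hy := dropPair_injective hx
  intro i i' h
  induction i using Fin.addCases with
  | left j =>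
    induction i' using Fin.addCases with
    | left j' =>
      simp only [Fin.append_left] at h
      exact congrArg _ (hy h)
    | right j' =>
      exfalso
      simp only [Fin.append_left, Fin.append_right] at h
      induction j using Fin.addCases with
      | left k =>
        simp only [Fin.append_left] at h
        fin_cases j' <;> · have := congrArg Fin.val (hx h); simp at this; omega
      | right k =>
        simp only [Fin.append_right] at h
        fin_cases j' <;> · have := congrArg Fin.val (hx h); simp at this; omega
  | right j =>
    induction i' using Fin.addCases with
    | left j' =>
      exfalso
      simp only [Fin.append_left, Fin.append_right] at h
      induction j' using Fin.addCases with
      | left k =>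
        simp only [Fin.append_left] at h
        fin_cases j <;> · have := congrArg Fin.val (hx h); simp at this; omega
      | right k =>
        simp only [Fin.append_right] at h
        fin_cases j <;> · have := congrArg Fin.val (hx h); simp at this; omega
    | right j' =>
      simp only [Fin.append_right] at h
      fin_cases j <;> fin_cases j'
      · rfl
      · have := congrArg Fin.val (hx h); simp at this
      · have := congrArg Fin.val (hx h); simp at this
      · rfl

/-- `z` is a reindexing of `x`: same critical correlator. [folklore] -/
theorem criticalCorr_reindex (m : ℕ) (X : Fin ((m + 1) + (m + 1)) → Site 3) :
    criticalCorr 3 ((m + m) + 2)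
        (Fin.append (Fin.append (fun j : Fin m => X (Fin.castAdd (m + 1) (Fin.castSucc j)))
            (fun j : Fin m => X (Fin.natAdd (m + 1) (Fin.castSucc j))))
          ![X (Fin.castAdd (m + 1) (Fin.last m)), X (Fin.natAdd (m + 1) (Fin.last m))]) =
      criticalCorr 3 ((m + 1) + (m + 1)) X := by
  show plusExpect 3 (criticalBeta 3) 0 (spinMonomial _) = plusExpect 3 (criticalBeta 3) 0 (spinMonomial X)
  congr 1
  funext s
  unfold spinMonomial
  rw [Fin.prod_univ_add, Fin.prod_univ_add, Fin.prod_univ_two]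
  conv_rhs => rw [Fin.prod_univ_add, Fin.prod_univ_castSucc, Fin.prod_univ_castSucc]
  simp only [Fin.append_left, Fin.append_right, Matrix.cons_val_zero, Matrix.cons_val_one]
  ring

end Reindex

/-! ## §C The exact lattice identity `Q_{m+1}(x) = Q_m(y) / R_{2m}(z)` -/

/-- `Q_{m+1}(x) = Q_m(y(x)) / R_{2m}(z(x))` on the lattice, for every mesh and every configuration. [folklore] -/
theorem pairing_succ_eq (m : ℕ) (δ : ℝ) (x : Fin ((m + 1) + (m + 1)) → EuclideanSpace ℝ (Fin 3)) :
    criticalCorr 3 ((m + 1) + (m + 1)) (fun i => latticeApprox δ (x i)) /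
        ∏ j : Fin (m + 1), criticalCorr 3 2 ![latticeApprox δ (x (Fin.castAdd (m + 1) j)), latticeApprox δ (x (Fin.natAdd (m + 1) j))] =
      (criticalCorr 3 (m + m) (fun i => latticeApprox δ ((Fin.append (fun j : Fin m => x (Fin.castAdd (m + 1) (Fin.castSucc j)))
          (fun j : Fin m => x (Fin.natAdd (m + 1) (Fin.castSucc j))) : Fin (m + m) → EuclideanSpace ℝ (Fin 3)) i)) /
        ∏ j : Fin m, criticalCorr 3 2 ![latticeApprox δ ((Fin.append (fun j : Fin m => x (Fin.castAdd (m + 1) (Fin.castSucc j)))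
          (fun j : Fin m => x (Fin.natAdd (m + 1) (Fin.castSucc j))) : Fin (m + m) → EuclideanSpace ℝ (Fin 3)) (Fin.castAdd m j)),
          latticeApprox δ ((Fin.append (fun j : Fin m => x (Fin.castAdd (m + 1) (Fin.castSucc j)))
          (fun j : Fin m => x (Fin.natAdd (m + 1) (Fin.castSucc j))) : Fin (m + m) → EuclideanSpace ℝ (Fin 3)) (Fin.natAdd m j))]) /
      (rescaledCorrelator (criticalCorr 3) 1 (m + m) δ (fun i => (Fin.append (Fin.append (fun j : Fin m => x (Fin.castAdd (m + 1) (Fin.castSucc j)))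
            (fun j : Fin m => x (Fin.natAdd (m + 1) (Fin.castSucc j))))
          ![x (Fin.castAdd (m + 1) (Fin.last m)), x (Fin.natAdd (m + 1) (Fin.last m))] : Fin ((m + m) + 2) → EuclideanSpace ℝ (Fin 3)) (Fin.castAdd 2 i)) *
        rescaledCorrelator (criticalCorr 3) 1 2 δ (fun i => (Fin.append (Fin.append (fun j : Fin m => x (Fin.castAdd (m + 1) (Fin.castSucc j)))
            (fun j : Fin m => x (Fin.natAdd (m + 1) (Fin.castSucc j))))
          ![x (Fin.castAdd (m + 1) (Fin.last m)), x (Fin.natAdd (m + 1) (Fin.last m))] : Fin ((m + m) + 2) → EuclideanSpace ℝ (Fin 3)) (Fin.natAdd (m + m) i)) /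
        rescaledCorrelator (criticalCorr 3) 1 ((m + m) + 2) δ (Fin.append (Fin.append (fun j : Fin m => x (Fin.castAdd (m + 1) (Fin.castSucc j)))
            (fun j : Fin m => x (Fin.natAdd (m + 1) (Fin.castSucc j))))
          ![x (Fin.castAdd (m + 1) (Fin.last m)), x (Fin.natAdd (m + 1) (Fin.last m))] : Fin ((m + m) + 2) → EuclideanSpace ℝ (Fin 3))) := by
  simp only [rescaledCorrelator_apply, Pi.one_apply, one_pow, one_mul, Fin.append_left, Fin.append_right]
  -- the `(m+m)+2`-point correlator of `z` is the `(m+1)+(m+1)`-point correlator of `x`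
  have hz : (fun i => latticeApprox δ ((Fin.append (Fin.append (fun j : Fin m => x (Fin.castAdd (m + 1) (Fin.castSucc j)))
            (fun j : Fin m => x (Fin.natAdd (m + 1) (Fin.castSucc j))))
          ![x (Fin.castAdd (m + 1) (Fin.last m)), x (Fin.natAdd (m + 1) (Fin.last m))] : Fin ((m + m) + 2) → EuclideanSpace ℝ (Fin 3)) i)) =
      Fin.append (Fin.append (fun j : Fin m => latticeApprox δ (x (Fin.castAdd (m + 1) (Fin.castSucc j))))
            (fun j : Fin m => latticeApprox δ (x (Fin.natAdd (m + 1) (Fin.castSucc j)))))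
          ![latticeApprox δ (x (Fin.castAdd (m + 1) (Fin.last m))), latticeApprox δ (x (Fin.natAdd (m + 1) (Fin.last m)))] := by
    funext i
    refine Fin.addCases (fun j => ?_) (fun j => ?_) i
    · simp only [Fin.append_left]
      refine Fin.addCases (fun k => ?_) (fun k => ?_) j <;> simp only [Fin.append_left, Fin.append_right]
    · simp only [Fin.append_right]
      fin_cases j <;> rfl
  have hy : (fun i => latticeApprox δ ((Fin.append (fun j : Fin m => x (Fin.castAdd (m + 1) (Fin.castSucc j)))
          (fun j : Fin m => x (Fin.natAdd (m + 1) (Fin.castSucc j))) : Fin (m + m) → EuclideanSpace ℝ (Fin 3)) i)) =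
      Fin.append (fun j : Fin m => latticeApprox δ (x (Fin.castAdd (m + 1) (Fin.castSucc j))))
            (fun j : Fin m => latticeApprox δ (x (Fin.natAdd (m + 1) (Fin.castSucc j)))) := by
    funext i
    refine Fin.addCases (fun j => ?_) (fun j => ?_) i <;> simp only [Fin.append_left, Fin.append_right]
  have h2 : (fun i : Fin 2 => latticeApprox δ ((![x (Fin.castAdd (m + 1) (Fin.last m)), x (Fin.natAdd (m + 1) (Fin.last m))] :
      Fin 2 → EuclideanSpace ℝ (Fin 3)) i)) = ![latticeApprox δ (x (Fin.castAdd (m + 1) (Fin.last m))), latticeApprox δ (x (Fin.natAdd (m + 1) (Fin.last m)))] := by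
    funext i; fin_cases i <;> rfl
  rw [hz, criticalCorr_reindex m (fun i => latticeApprox δ (x i)), hy, h2, Fin.prod_univ_castSucc]
  -- positivity of everything in sight, then algebra
  have hG := criticalCorr_pos_of_even (n := (m + 1) + (m + 1)) ⟨m + 1, rfl⟩ (fun i => latticeApprox δ (x i))
  have hGy := criticalCorr_pos_of_even (n := m + m) ⟨m, rfl⟩
    (Fin.append (fun j : Fin m => latticeApprox δ (x (Fin.castAdd (m + 1) (Fin.castSucc j))))
      (fun j : Fin m => latticeApprox δ (x (Fin.natAdd (m + 1) (Fin.castSucc j)))))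
  have hP : (∏ j : Fin m, criticalCorr 3 2 ![latticeApprox δ (x (Fin.castAdd (m + 1) (Fin.castSucc j))),
      latticeApprox δ (x (Fin.natAdd (m + 1) (Fin.castSucc j)))]) ≠ 0 :=
    Finset.prod_ne_zero_iff.2 fun j _ => (criticalCorr_two_pos' _ _).ne'
  have hg := criticalCorr_two_pos' (latticeApprox δ (x (Fin.castAdd (m + 1) (Fin.last m)))) (latticeApprox δ (x (Fin.natAdd (m + 1) (Fin.last m))))
  field_simp

/-! ## §D Induction on the level and assembly -/

/-- `y(x)` is non-coincident when `x` is. [folklore] -/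
theorem dropPair_mapsTo (m : ℕ) :
    MapsTo (fun x : Fin ((m + 1) + (m + 1)) → EuclideanSpace ℝ (Fin 3) => (Fin.append (fun j : Fin m => x (Fin.castAdd (m + 1) (Fin.castSucc j))) (fun j : Fin m => x (Fin.natAdd (m + 1) (Fin.castSucc j))) : Fin (m + m) → EuclideanSpace ℝ (Fin 3)))
      (NonCoincident 3 ((m + 1) + (m + 1))) (NonCoincident 3 (m + m)) :=
  fun x hx => (mem_nonCoincident _).2 (dropPair_injective ((mem_nonCoincident x).1 hx))

/-- `z(x)` is non-coincident when `x` is. [folklore] -/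
theorem reindex_mapsTo (m : ℕ) :
    MapsTo (fun x : Fin ((m + 1) + (m + 1)) → EuclideanSpace ℝ (Fin 3) => (Fin.append (Fin.append (fun j : Fin m => x (Fin.castAdd (m + 1) (Fin.castSucc j))) (fun j : Fin m => x (Fin.natAdd (m + 1) (Fin.castSucc j)))) ![x (Fin.castAdd (m + 1) (Fin.last m)), x (Fin.natAdd (m + 1) (Fin.last m))] : Fin ((m + m) + 2) → EuclideanSpace ℝ (Fin 3)))
      (NonCoincident 3 ((m + 1) + (m + 1))) (NonCoincident 3 ((m + m) + 2)) :=
  fun x hx => (mem_nonCoincident _).2 (reindex_injective ((mem_nonCoincident x).1 hx))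

/-- THE INDUCTION: continuous locally uniform pairing-ratio limits at every level `m ≥ 1`, from item 4841. [folklore] -/
theorem ratioLimit_induction (hRL : Summit.CriticalPhenomena.Ising3DConformalLimit.Theses.CurrentConnectionInvariance.RatioLimit) :
    ∀ m : ℕ, 1 ≤ m → ∃ g : (Fin (m + m) → EuclideanSpace ℝ (Fin 3)) → ℝ, ContinuousOn g (NonCoincident 3 (m + m)) ∧
      TendstoLocallyUniformlyOn (fun (δ : ℝ) (x : Fin (m + m) → EuclideanSpace ℝ (Fin 3)) => Literature.Probability.LatticeModels.criticalCorr 3 (m + m) (fun i => Literature.Probability.LatticeModels.latticeApprox δ (x i)) / ∏ j : Fin m, Literature.Probability.LatticeModels.criticalCorr 3 2 ![Literature.Probability.LatticeModels.latticeApprox δ (x (Fin.castAdd m j)), Literature.Probability.LatticeModels.latticeApprox δ (x (Fin.natAdd m j))]) g (𝓝[>] (0:ℝ)) (NonCoincident 3 (m + m)) := by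
  refine Nat.le_induction ?_ ?_
  · refine ⟨fun _ => 1, continuousOn_const, ?_⟩
    refine ((tendsto_const_nhds (x := (1:ℝ))).tendstoUniformlyOn_const _).tendstoLocallyUniformlyOn.congr ?_
    intro δ x _
    exact (pairingRatio_level_one δ x).symm
  · intro m hm ih
    obtain ⟨g, hgc, hg⟩ := ih
    obtain ⟨p, hpc, hppos, hR⟩ := hRL (m + m) ⟨m, rfl⟩ (by omega)
    have hQy := hg.comp (fun x : Fin ((m + 1) + (m + 1)) → EuclideanSpace ℝ (Fin 3) => (Fin.append (fun j : Fin m => x (Fin.castAdd (m + 1) (Fin.castSucc j))) (fun j : Fin m => x (Fin.natAdd (m + 1) (Fin.castSucc j))) : Fin (m + m) → EuclideanSpace ℝ (Fin 3))) (dropPair_mapsTo m)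
      (continuous_dropPair m).continuousOn
    have hRz := hR.comp (fun x : Fin ((m + 1) + (m + 1)) → EuclideanSpace ℝ (Fin 3) => (Fin.append (Fin.append (fun j : Fin m => x (Fin.castAdd (m + 1) (Fin.castSucc j))) (fun j : Fin m => x (Fin.natAdd (m + 1) (Fin.castSucc j)))) ![x (Fin.castAdd (m + 1) (Fin.last m)), x (Fin.natAdd (m + 1) (Fin.last m))] : Fin ((m + m) + 2) → EuclideanSpace ℝ (Fin 3))) (reindex_mapsTo m)
      (continuous_reindex m).continuousOn
    have hgc' : ContinuousOn (fun x : Fin ((m + 1) + (m + 1)) → EuclideanSpace ℝ (Fin 3) => g (Fin.append (fun j : Fin m => x (Fin.castAdd (m + 1) (Fin.castSucc j))) (fun j : Fin m => x (Fin.natAdd (m + 1) (Fin.castSucc j))) : Fin (m + m) → EuclideanSpace ℝ (Fin 3)))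
        (NonCoincident 3 ((m + 1) + (m + 1))) :=
      hgc.comp (continuous_dropPair m).continuousOn (dropPair_mapsTo m)
    have hpc' : ContinuousOn (fun x : Fin ((m + 1) + (m + 1)) → EuclideanSpace ℝ (Fin 3) => p (Fin.append (Fin.append (fun j : Fin m => x (Fin.castAdd (m + 1) (Fin.castSucc j))) (fun j : Fin m => x (Fin.natAdd (m + 1) (Fin.castSucc j)))) ![x (Fin.castAdd (m + 1) (Fin.last m)), x (Fin.natAdd (m + 1) (Fin.last m))] : Fin ((m + m) + 2) → EuclideanSpace ℝ (Fin 3)))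
        (NonCoincident 3 ((m + 1) + (m + 1))) :=
      hpc.comp (continuous_reindex m).continuousOn (reindex_mapsTo m)
    have hne : ∀ x ∈ NonCoincident 3 ((m + 1) + (m + 1)), p (Fin.append (Fin.append (fun j : Fin m => x (Fin.castAdd (m + 1) (Fin.castSucc j))) (fun j : Fin m => x (Fin.natAdd (m + 1) (Fin.castSucc j)))) ![x (Fin.castAdd (m + 1) (Fin.last m)), x (Fin.natAdd (m + 1) (Fin.last m))] : Fin ((m + m) + 2) → EuclideanSpace ℝ (Fin 3)) ≠ 0 := fun x hx => (hppos _ (reindex_mapsTo m hx)).ne'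
    have hdiv := hQy.div₀ hRz hgc' hpc' hne
    refine ⟨fun x => g (Fin.append (fun j : Fin m => x (Fin.castAdd (m + 1) (Fin.castSucc j))) (fun j : Fin m => x (Fin.natAdd (m + 1) (Fin.castSucc j))) : Fin (m + m) → EuclideanSpace ℝ (Fin 3)) / p (Fin.append (Fin.append (fun j : Fin m => x (Fin.castAdd (m + 1) (Fin.castSucc j))) (fun j : Fin m => x (Fin.natAdd (m + 1) (Fin.castSucc j)))) ![x (Fin.castAdd (m + 1) (Fin.last m)), x (Fin.natAdd (m + 1) (Fin.last m))] : Fin ((m + m) + 2) → EuclideanSpace ℝ (Fin 3)), hgc'.div hpc' hne, ?_⟩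
    refine hdiv.congr ?_
    intro δ x _
    simp only [Pi.div_apply, Function.comp_apply]
    exact (pairing_succ_eq m δ x).symm

/-- Level `0`: the pairing ratio is `⟨1⟩ / 1 = 1`. [folklore] -/
theorem pairingRatio_level_zero (δ : ℝ) (x : Fin (0 + 0) → EuclideanSpace ℝ (Fin 3)) :
    criticalCorr 3 (0 + 0) (fun i => latticeApprox δ (x i)) /
      ∏ j : Fin 0, criticalCorr 3 2 ![latticeApprox δ (x (Fin.castAdd 0 j)), latticeApprox δ (x (Fin.natAdd 0 j))] = 1 := by
  rw [Finset.univ_eq_empty, Finset.prod_empty, div_one]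
  show plusExpect 3 (criticalBeta 3) 0 (spinMonomial _) = 1
  have h : spinMonomial (fun i : Fin (0 + 0) => latticeApprox δ (x i)) = fun _ => (1 : ℝ) := by
    funext s
    unfold spinMonomial
    exact Finset.prod_eq_one fun i _ => i.elim0
  rw [h, plusExpect_one]

/-- **Registered sub-goal `ratioLimitExists_of_CCIRatioLimit`: the OPEN stub `stub_ratioLimitExists` of crux stmt-4530 from
item stmt-CriticalPhenomena-4841 `CurrentConnectionInvariance.RatioLimit`.** [folklore] -/
theorem ratioLimitExists_of_CCIRatioLimit :
    Summit.CriticalPhenomena.Ising3DConformalLimit.Theses.CurrentConnectionInvariance.RatioLimit → ∃ q : Literature.Probability.LatticeModels.CorrFamily 3, ∀ m : ℕ, TendstoLocallyUniformlyOn (fun (δ : ℝ) (x : Fin (m + m) → EuclideanSpace ℝ (Fin 3)) => Literature.Probability.LatticeModels.criticalCorr 3 (m + m) (fun i => Literature.Probability.LatticeModels.latticeApprox δ (x i)) / ∏ j : Fin m, Literature.Probability.LatticeModels.criticalCorr 3 2 ![Literature.Probability.LatticeModels.latticeApprox δ (x (Fin.castAdd m j)), Literature.Probability.LatticeModels.latticeApprox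 δ (x (Fin.natAdd m j))]) (q (m + m)) (nhdsWithin 0 (Set.Ioi 0)) (Literature.Probability.LatticeModels.NonCoincident 3 (m + m)) := by
  intro hRL
  have hex : ∀ m : ℕ, ∃ g : (Fin (m + m) → EuclideanSpace ℝ (Fin 3)) → ℝ,
      TendstoLocallyUniformlyOn (fun (δ : ℝ) (x : Fin (m + m) → EuclideanSpace ℝ (Fin 3)) => Literature.Probability.LatticeModels.criticalCorr 3 (m + m) (fun i => Literature.Probability.LatticeModels.latticeApprox δ (x i)) / ∏ j : Fin m, Literature.Probability.LatticeModels.criticalCorr 3 2 ![Literature.Probability.LatticeModels.latticeApprox δ (x (Fin.castAdd m j)), Literature.Probability.LatticeModels.latticeApprox δ (x (Fin.natAdd m j))]) g (𝓝[>] (0:ℝ)) (NonCoincident 3 (m + m)) := by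
    intro m
    rcases Nat.eq_zero_or_pos m with rfl | hm
    · refine ⟨fun _ => 1, ?_⟩
      refine ((tendsto_const_nhds (x := (1:ℝ))).tendstoUniformlyOn_const _).tendstoLocallyUniformlyOn.congr ?_
      intro δ x _
      exact (pairingRatio_level_zero δ x).symm
    · obtain ⟨g, -, hg⟩ := ratioLimit_induction hRL m hm
      exact ⟨g, hg⟩
  choose g hg using hex
  -- `q n` reads the first `n/2 + n/2` coordinates (all of them when `n` is even) through `g (n/2)`
  refine ⟨fun n x => g (n / 2) (fun i => x (Fin.castLE (by omega) i)), fun m => ?_⟩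
  have key : ∀ (k : ℕ) (hk : k = m) (h : k + k ≤ m + m) (x : Fin (m + m) → EuclideanSpace ℝ (Fin 3)),
      g k (fun i => x (Fin.castLE h i)) = g m x := by
    intro k hk h x
    subst hk
    rfl
  refine (hg m).congr_right fun x _ => ?_
  exact (key ((m + m) / 2) (by omega) _ x).symm

end Summit.CriticalPhenomena.Ising3DConformalLimit.Cruxes.SpinRatioMoebius.Birth

end
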